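/-
Copyright: the b2b-balaban T⁴-continuum CRUX team, row NE7b OWNER lineage `t4-ne7b-p1` (gen 137). Project licence.
-/
import Summits.QuantumFields.BalabanUV.T4Continuum.Spine.NE7b.SupBlockLocality
import Summits.QuantumFields.BalabanUV.T4Continuum.Spine.NE7b.SupBlockResidualRegulated

/-!
# THE `Σ_Y` FORMS — FOR A `Y`-LOCAL BLOCK INPUT THE RESIDUAL'S LETTERS LIVE ON `Y`: (409)'s global letter, typed with `Σ_i` over all sites
# because (401)'s secant hypothesis is, REDUCES for a `Y`-local `U` ((412)) to
#   `|r(ζ)| ≤ (λ + ½Λ)·Σ_Yζ²`   for EVERY `ζ`,   `r(ζ) = log Z(ψ₀+ζ) − log Z(ψ₀) + ⟨b_D,ζ⟩ + ½ζᵀK_Dζ = r(ζ^Y)`   (`ζ^Y = 1_Y·ζ`),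
# because each of its four terms sees `ζ|_Y` only (`Z` local, `b_D` on `Y`, the Hessian CLM kills off-`Y` directions in both slots); hence the
# OUTPUT single-block potential `w⁺ = −r` of the dressed step is `Y`-local with
#   stability `−(λ+½Λ)·Σ_Yζ² ≤ w⁺(ζ)`   and   upper growth `w⁺(ζ) ≤ (λ+½Λ)·(0 + Σ_Yζ²)`
# — the INPUT format's `hstab` ∕ `hUup` REGENERATED with `(κ₀⁺, κ_u⁺, a_u⁺) = (λ+½Λ, λ+½Λ, 0)`, uniform in the background and the volume
# (row NE7b, node U5c; (409)∕(412) BY NAME; [folklore])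

Cell `pub-balaban`, sub-cell `t4`, spine estimate NE7b (`T4WeightBudget.RelWeightBound`; the cell's OWN estimate — NOT PRINTED in
[Bałaban 1983–89], NOT PROVED).  Crux-route work under `Spine/NE7b/` by the row OWNER (`t4-ne7b-p1` gen 137, file (413)) under FREEZE
(0)'s crux-prover clause, on gen 136's SCOPING-d8 (β1); NOTHING of Bałaban's is named as a Lean object, valued or asserted; no
`T4Continuum/Support` leaf typed; no `def`, no notation (`b_D`, `K_D`, `ζ^Y` WRITTEN OUT); zero `sorry`.  Imports (BY NAME): the OWNER's (412)
`…SupBlockLocality` (`block_Z_local`, `block_fderiv_W_apply_eq_zero_off`, `block_hessianCLM_apply_off`, `block_hessianCLM_apply_apply_off`),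
(409) `…SupBlockResidualRegulated` (`block_residual_global_letter`), and through them (388) (`clm₁_apply_eq_dot`, `symmMatrix_form_eq`).

WHAT IS PROVED ([folklore]; `Z(ψ) = ∫e^{−U(ω+ψ)}dN(0,M⁻¹)`):
* §1 `block_linear_local` (`⟨b_D,ζ⟩ = ⟨b_D,ζ^Y⟩`), `block_quadratic_local` (`ζᵀK_Dζ = (ζ^Y)ᵀK_Dζ^Y`), **`block_residual_local`** (`r(ζ) = r(ζ^Y)`);
* §2 THE END **`block_residual_global_letter_local`** (`|r(ζ)| ≤ (λ+½Λ)Σ_Yζ²` for EVERY `ζ`), **`block_output_stability_and_growth`**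
  (`−((λ+½Λ)Σ_Yζ²) ≤ w⁺(ζ) ≤ (λ+½Λ)(0 + Σ_Yζ²)`); §3 toy.

HONEST (what this is NOT).  Support bookkeeping over (409)∕(412); the output's remaining INPUT letters (`κ₁⁺` gradient, `κ₂⁺`, `κ₃⁺`, the secant
form of the lower class letter) are the successor's; no contraction ((β4)), no decaying-covariance polymer expansion ((β3′)); scalar skeleton
((A3), NC-NE7b-α UNRULED); nothing of Bałaban's asserted.  BY-NAME EFFECT ON THE WALL: NONE.  NE7b NOT PRINTED ∕ NOT PROVED; spine PROVED 0∕9;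
rung (B)+1 — the programme's measures remain FINITE-torus statements; NOT the mass gap, NOT Clay.  HONEST DEPENDENCY: continuum YM on T⁴ ⇐
BetaPertH ∧ nine spine estimates (0∕9 proved); BetaPertH ⇐ (D1) ∧ (D4) ∧ CAP+tail; G-an2-4 gates asym, D1 and NE2∕3∕4.
-/

set_option autoImplicit false
set_option maxSynthPendingDepth 2

noncomputable section

namespace Summit.QuantumFields.BalabanUV.T4Continuum.NE7b.SupBlockLocalResidual

open MeasureTheory ProbabilityTheory Finset Real Matrix
open scoped BigOperators
open SupNextHessianMatrix (clm₁_apply_eq_dot symmMatrix_form_eq)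
open SupBlockLocality (block_Z_local block_fderiv_W_apply_eq_zero_off block_hessianCLM_apply_off block_hessianCLM_apply_apply_off)
open SupBlockResidualRegulated (block_residual_global_letter)

variable {ι : Type} [Fintype ι] [DecidableEq ι]

section Local

variable {M : Matrix ι ι ℝ} {γop m lam : ℝ} {U : EuclideanSpace ℝ ι → ℝ} {U' : EuclideanSpace ℝ ι → EuclideanSpace ℝ ι →L[ℝ] ℝ}
  {U'' : EuclideanSpace ℝ ι → EuclideanSpace ℝ ι →L[ℝ] EuclideanSpace ℝ ι →L[ℝ] ℝ} {κ₀ κ₁ κ₂ a τ δ θ : ℝ}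

/-! ## §1. Each term of the residual sees `ζ|_Y` only -/

/-- **`⟨b_D(ψ₀), ζ⟩ = ⟨b_D(ψ₀), ζ^Y⟩`** (`DW(ψ₀)` kills `ζ − ζ^Y`, supported off `Y`). [folklore] -/
theorem block_linear_local (hM : M.PosDef) (hΓop : (γop • (1 : Matrix ι ι ℝ) - M⁻¹).PosSemidef) (Y : Finset ι)
    (hUd : ∀ φ : EuclideanSpace ℝ ι, HasFDerivAt U (U' φ) φ) (hU'c : Continuous U')
    (hκ₀ : 0 ≤ κ₀) (hκ₁ : 0 ≤ κ₁) (ha : 0 ≤ a) (hτ : 0 < τ) (hδ : 0 < δ) (hθ0 : 0 < θ) (hθ1 : θ < 1)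
    (hκθ : (2 * κ₀ * (1 + τ) + 4 * δ) * γop ≤ θ) (hstab : ∀ φ : EuclideanSpace ℝ ι, -(κ₀ * ∑ x ∈ Y, φ x ^ 2) ≤ U φ)
    (hU'b : ∀ φ : EuclideanSpace ℝ ι, ‖U' φ‖ ≤ κ₁ * (a + ∑ x ∈ Y, φ x ^ 2)) (hUloc : ∀ φ φ' : EuclideanSpace ℝ ι, (∀ x ∈ Y, φ x = φ' x) → U φ = U φ') (ψ₀ ζ : EuclideanSpace
        ℝ ι) :
    ((fun x : ι => ((∫ ω : EuclideanSpace ℝ ι, exp (-U (ω + ψ₀)) ∂(multivariateGaussian 0 M⁻¹))⁻¹ • ∫ ω : EuclideanSpace ℝ ι, exp (-U (ω + ψ₀)) • U' (ω + ψ₀)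
        ∂(multivariateGaussian 0 M⁻¹)) (EuclideanSpace.single x (1 : ℝ))) ⬝ᵥ (WithLp.ofLp ζ)) = ((fun x : ι => ((∫ ω : EuclideanSpace ℝ ι, exp (-U (ω + ψ₀))
        ∂(multivariateGaussian 0 M⁻¹))⁻¹ • ∫ ω : EuclideanSpace ℝ ι, exp (-U (ω + ψ₀)) • U' (ω + ψ₀) ∂(multivariateGaussian 0 M⁻¹)) (EuclideanSpace.single x (1 : ℝ))) ⬝ᵥ
        (WithLp.ofLp (WithLp.toLp 2 (fun x : ι => if x ∈ Y then ζ x else 0) : EuclideanSpace ℝ ι))) := by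
  have hΓ : (M⁻¹).PosSemidef := hM.inv.posSemidef
  have hoffv : ∀ x ∈ Y, (ζ - (WithLp.toLp 2 (fun x : ι => if x ∈ Y then ζ x else 0) : EuclideanSpace ℝ ι)) x = 0 := fun x hx => by simp [hx]
  have h0 := block_fderiv_W_apply_eq_zero_off hΓ hΓop Y hUd hU'c hκ₀ hκ₁ ha hτ hδ hθ0 hθ1 hκθ hstab hU'b hUloc ψ₀ (ζ - (WithLp.toLp 2 (fun x : ι => if x ∈ Y then ζ x else
      0) : EuclideanSpace ℝ ι)) hoffv
  rw [clm₁_apply_eq_dot, WithLp.ofLp_sub, dotProduct_sub, sub_eq_zero] at h0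
  exact h0

/-- **`ζᵀK_D(ψ₀)ζ = (ζ^Y)ᵀK_D(ψ₀)ζ^Y`** (the Hessian CLM kills `ζ − ζ^Y` in both slots; `K_D` represents it by (388)). [folklore] -/
theorem block_quadratic_local (hM : M.PosDef) (hΓop : (γop • (1 : Matrix ι ι ℝ) - M⁻¹).PosSemidef) (Y : Finset ι)
    (hUd : ∀ φ : EuclideanSpace ℝ ι, HasFDerivAt U (U' φ) φ) (hU'd : ∀ φ : EuclideanSpace ℝ ι, HasFDerivAt U' (U'' φ) φ)
    (hU''c : Continuous U'') (hκ₀ : 0 ≤ κ₀) (hκ₁ : 0 ≤ κ₁) (ha : 0 ≤ a) (hκ₂ : 0 ≤ κ₂) (hτ : 0 < τ) (hδ : 0 < δ) (hθ0 : 0 < θ) (hθ1 : θ < 1)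
    (hκθ : (2 * κ₀ * (1 + τ) + 4 * δ) * γop ≤ θ) (hstab : ∀ φ : EuclideanSpace ℝ ι, -(κ₀ * ∑ x ∈ Y, φ x ^ 2) ≤ U φ)
    (hU'b : ∀ φ : EuclideanSpace ℝ ι, ‖U' φ‖ ≤ κ₁ * (a + ∑ x ∈ Y, φ x ^ 2)) (hU''b : ∀ φ : EuclideanSpace ℝ ι, ‖U'' φ‖ ≤ κ₂)
    (hUloc : ∀ φ φ' : EuclideanSpace ℝ ι, (∀ x ∈ Y, φ x = φ' x) → U φ = U φ') (ψ₀ ζ : EuclideanSpace ℝ ι) :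
    ((WithLp.ofLp ζ) ⬝ᵥ (Matrix.of fun x y : ι => (((∫ ω : EuclideanSpace ℝ ι, exp (-U (ω + ψ₀)) ∂(multivariateGaussian 0 M⁻¹))⁻¹ • (∫ ω : EuclideanSpace ℝ ι, exp (-U (ω +
        ψ₀)) • (U'' (ω + ψ₀) - (U' (ω + ψ₀)).smulRight (U' (ω + ψ₀))) ∂(multivariateGaussian 0 M⁻¹)) + (((∫ ω : EuclideanSpace ℝ ι, exp (-U (ω + ψ₀)) ∂(multivariateGaussian
        0 M⁻¹)) ^ 2)⁻¹ • ∫ ω : EuclideanSpace ℝ ι, exp (-U (ω + ψ₀)) • U' (ω + ψ₀) ∂(multivariateGaussian 0 M⁻¹)).smulRight (∫ ω : EuclideanSpace ℝ ι, exp (-U (ω + ψ₀)) •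
        U' (ω + ψ₀) ∂(multivariateGaussian 0 M⁻¹))) (EuclideanSpace.single x (1 : ℝ)) (EuclideanSpace.single y (1 : ℝ)) + ((∫ ω : EuclideanSpace ℝ ι, exp (-U (ω + ψ₀))
        ∂(multivariateGaussian 0 M⁻¹))⁻¹ • (∫ ω : EuclideanSpace ℝ ι, exp (-U (ω + ψ₀)) • (U'' (ω + ψ₀) - (U' (ω + ψ₀)).smulRight (U' (ω + ψ₀))) ∂(multivariateGaussian 0
        M⁻¹)) + (((∫ ω : EuclideanSpace ℝ ι, exp (-U (ω + ψ₀)) ∂(multivariateGaussian 0 M⁻¹)) ^ 2)⁻¹ • ∫ ω : EuclideanSpace ℝ ι, exp (-U (ω + ψ₀)) • U' (ω + ψ₀)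
        ∂(multivariateGaussian 0 M⁻¹)).smulRight (∫ ω : EuclideanSpace ℝ ι, exp (-U (ω + ψ₀)) • U' (ω + ψ₀) ∂(multivariateGaussian 0 M⁻¹))) (EuclideanSpace.single y (1 :
        ℝ)) (EuclideanSpace.single x (1 : ℝ))) / 2) *ᵥ (WithLp.ofLp ζ)) = ((WithLp.ofLp (WithLp.toLp 2 (fun x : ι => if x ∈ Y then ζ x else 0) : EuclideanSpace ℝ ι)) ⬝ᵥ
        (Matrix.of fun x y : ι => (((∫ ω : EuclideanSpace ℝ ι, exp (-U (ω + ψ₀)) ∂(multivariateGaussian 0 M⁻¹))⁻¹ • (∫ ω : EuclideanSpace ℝ ι, exp (-U (ω + ψ₀)) • (U'' (ω +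
        ψ₀) - (U' (ω + ψ₀)).smulRight (U' (ω + ψ₀))) ∂(multivariateGaussian 0 M⁻¹)) + (((∫ ω : EuclideanSpace ℝ ι, exp (-U (ω + ψ₀)) ∂(multivariateGaussian 0 M⁻¹)) ^ 2)⁻¹ •
        ∫ ω : EuclideanSpace ℝ ι, exp (-U (ω + ψ₀)) • U' (ω + ψ₀) ∂(multivariateGaussian 0 M⁻¹)).smulRight (∫ ω : EuclideanSpace ℝ ι, exp (-U (ω + ψ₀)) • U' (ω + ψ₀)
        ∂(multivariateGaussian 0 M⁻¹))) (EuclideanSpace.single x (1 : ℝ)) (EuclideanSpace.single y (1 : ℝ)) + ((∫ ω : EuclideanSpace ℝ ι, exp (-U (ω + ψ₀))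
        ∂(multivariateGaussian 0 M⁻¹))⁻¹ • (∫ ω : EuclideanSpace ℝ ι, exp (-U (ω + ψ₀)) • (U'' (ω + ψ₀) - (U' (ω + ψ₀)).smulRight (U' (ω + ψ₀))) ∂(multivariateGaussian 0
        M⁻¹)) + (((∫ ω : EuclideanSpace ℝ ι, exp (-U (ω + ψ₀)) ∂(multivariateGaussian 0 M⁻¹)) ^ 2)⁻¹ • ∫ ω : EuclideanSpace ℝ ι, exp (-U (ω + ψ₀)) • U' (ω + ψ₀)
        ∂(multivariateGaussian 0 M⁻¹)).smulRight (∫ ω : EuclideanSpace ℝ ι, exp (-U (ω + ψ₀)) • U' (ω + ψ₀) ∂(multivariateGaussian 0 M⁻¹))) (EuclideanSpace.single y (1 :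
        ℝ)) (EuclideanSpace.single x (1 : ℝ))) / 2) *ᵥ (WithLp.ofLp (WithLp.toLp 2 (fun x : ι => if x ∈ Y then ζ x else 0) : EuclideanSpace ℝ ι))) := by
  have hΓ : (M⁻¹).PosSemidef := hM.inv.posSemidef
  have hoffv : ∀ x ∈ Y, (ζ - (WithLp.toLp 2 (fun x : ι => if x ∈ Y then ζ x else 0) : EuclideanSpace ℝ ι)) x = 0 := fun x hx => by simp [hx]
  have hoff1 : ((∫ ω : EuclideanSpace ℝ ι, exp (-U (ω + ψ₀)) ∂(multivariateGaussian 0 M⁻¹))⁻¹ • (∫ ω : EuclideanSpace ℝ ι, exp (-U (ω + ψ₀)) • (U'' (ω + ψ₀) - (U' (ω +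
      ψ₀)).smulRight (U' (ω + ψ₀))) ∂(multivariateGaussian 0 M⁻¹)) + (((∫ ω : EuclideanSpace ℝ ι, exp (-U (ω + ψ₀)) ∂(multivariateGaussian 0 M⁻¹)) ^ 2)⁻¹ • ∫ ω :
      EuclideanSpace ℝ ι, exp (-U (ω + ψ₀)) • U' (ω + ψ₀) ∂(multivariateGaussian 0 M⁻¹)).smulRight (∫ ω : EuclideanSpace ℝ ι, exp (-U (ω + ψ₀)) • U' (ω + ψ₀)
      ∂(multivariateGaussian 0 M⁻¹))) (ζ - (WithLp.toLp 2 (fun x : ι => if x ∈ Y then ζ x else 0) : EuclideanSpace ℝ ι)) = 0 := block_hessianCLM_apply_off hΓ hΓop Y hUd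
      hU'd hU''c hκ₀ hκ₁ ha hκ₂ hτ hδ hθ0 hθ1 hκθ hstab hU'b hU''b hUloc ψ₀ _ hoffv
  have hoff2 : ((∫ ω : EuclideanSpace ℝ ι, exp (-U (ω + ψ₀)) ∂(multivariateGaussian 0 M⁻¹))⁻¹ • (∫ ω : EuclideanSpace ℝ ι, exp (-U (ω + ψ₀)) • (U'' (ω + ψ₀) - (U' (ω +
      ψ₀)).smulRight (U' (ω + ψ₀))) ∂(multivariateGaussian 0 M⁻¹)) + (((∫ ω : EuclideanSpace ℝ ι, exp (-U (ω + ψ₀)) ∂(multivariateGaussian 0 M⁻¹)) ^ 2)⁻¹ • ∫ ω :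
      EuclideanSpace ℝ ι, exp (-U (ω + ψ₀)) • U' (ω + ψ₀) ∂(multivariateGaussian 0 M⁻¹)).smulRight (∫ ω : EuclideanSpace ℝ ι, exp (-U (ω + ψ₀)) • U' (ω + ψ₀)
      ∂(multivariateGaussian 0 M⁻¹))) (WithLp.toLp 2 (fun x : ι => if x ∈ Y then ζ x else 0) : EuclideanSpace ℝ ι) (ζ - (WithLp.toLp 2 (fun x : ι => if x ∈ Y then ζ x else
      0) : EuclideanSpace ℝ ι)) = 0 := block_hessianCLM_apply_apply_off hΓ hΓop Y hUd hU'd hU''c hκ₀ hκ₁ ha hκ₂ hτ hδ hθ0 hθ1 hκθ hstab hU'b hU''b hUloc ψ₀ _ _ hoffv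
  rw [symmMatrix_form_eq ((∫ ω : EuclideanSpace ℝ ι, exp (-U (ω + ψ₀)) ∂(multivariateGaussian 0 M⁻¹))⁻¹ • (∫ ω : EuclideanSpace ℝ ι, exp (-U (ω + ψ₀)) • (U'' (ω + ψ₀) - (U'
      (ω + ψ₀)).smulRight (U' (ω + ψ₀))) ∂(multivariateGaussian 0 M⁻¹)) + (((∫ ω : EuclideanSpace ℝ ι, exp (-U (ω + ψ₀)) ∂(multivariateGaussian 0 M⁻¹)) ^ 2)⁻¹ • ∫ ω :
      EuclideanSpace ℝ ι, exp (-U (ω + ψ₀)) • U' (ω + ψ₀) ∂(multivariateGaussian 0 M⁻¹)).smulRight (∫ ω : EuclideanSpace ℝ ι, exp (-U (ω + ψ₀)) • U' (ω + ψ₀)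
      ∂(multivariateGaussian 0 M⁻¹))) ζ, symmMatrix_form_eq ((∫ ω : EuclideanSpace ℝ ι, exp (-U (ω + ψ₀)) ∂(multivariateGaussian 0 M⁻¹))⁻¹ • (∫ ω : EuclideanSpace ℝ ι, exp
      (-U (ω + ψ₀)) • (U'' (ω + ψ₀) - (U' (ω + ψ₀)).smulRight (U' (ω + ψ₀))) ∂(multivariateGaussian 0 M⁻¹)) + (((∫ ω : EuclideanSpace ℝ ι, exp (-U (ω + ψ₀))
      ∂(multivariateGaussian 0 M⁻¹)) ^ 2)⁻¹ • ∫ ω : EuclideanSpace ℝ ι, exp (-U (ω + ψ₀)) • U' (ω + ψ₀) ∂(multivariateGaussian 0 M⁻¹)).smulRight (∫ ω : EuclideanSpace ℝ ι,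
      exp (-U (ω + ψ₀)) • U' (ω + ψ₀) ∂(multivariateGaussian 0 M⁻¹))) (WithLp.toLp 2 (fun x : ι => if x ∈ Y then ζ x else 0) : EuclideanSpace ℝ ι)]
  have e : ζ = (WithLp.toLp 2 (fun x : ι => if x ∈ Y then ζ x else 0) : EuclideanSpace ℝ ι) + (ζ - (WithLp.toLp 2 (fun x : ι => if x ∈ Y then ζ x else 0) : EuclideanSpace ℝ
      ι)) := (add_sub_cancel (WithLp.toLp 2 (fun x : ι => if x ∈ Y then ζ x else 0) : EuclideanSpace ℝ ι) ζ).symm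
  conv_lhs => rw [e]
  rw [show ((∫ ω : EuclideanSpace ℝ ι, exp (-U (ω + ψ₀)) ∂(multivariateGaussian 0 M⁻¹))⁻¹ • (∫ ω : EuclideanSpace ℝ ι, exp (-U (ω + ψ₀)) • (U'' (ω + ψ₀) - (U' (ω +
      ψ₀)).smulRight (U' (ω + ψ₀))) ∂(multivariateGaussian 0 M⁻¹)) + (((∫ ω : EuclideanSpace ℝ ι, exp (-U (ω + ψ₀)) ∂(multivariateGaussian 0 M⁻¹)) ^ 2)⁻¹ • ∫ ω :
      EuclideanSpace ℝ ι, exp (-U (ω + ψ₀)) • U' (ω + ψ₀) ∂(multivariateGaussian 0 M⁻¹)).smulRight (∫ ω : EuclideanSpace ℝ ι, exp (-U (ω + ψ₀)) • U' (ω + ψ₀)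
      ∂(multivariateGaussian 0 M⁻¹))) ((WithLp.toLp 2 (fun x : ι => if x ∈ Y then ζ x else 0) : EuclideanSpace ℝ ι) + (ζ - (WithLp.toLp 2 (fun x : ι => if x ∈ Y then ζ x
      else 0) : EuclideanSpace ℝ ι))) = ((∫ ω : EuclideanSpace ℝ ι, exp (-U (ω + ψ₀)) ∂(multivariateGaussian 0 M⁻¹))⁻¹ • (∫ ω : EuclideanSpace ℝ ι, exp (-U (ω + ψ₀)) • (U''
      (ω + ψ₀) - (U' (ω + ψ₀)).smulRight (U' (ω + ψ₀))) ∂(multivariateGaussian 0 M⁻¹)) + (((∫ ω : EuclideanSpace ℝ ι, exp (-U (ω + ψ₀)) ∂(multivariateGaussian 0 M⁻¹)) ^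
      2)⁻¹ • ∫ ω : EuclideanSpace ℝ ι, exp (-U (ω + ψ₀)) • U' (ω + ψ₀) ∂(multivariateGaussian 0 M⁻¹)).smulRight (∫ ω : EuclideanSpace ℝ ι, exp (-U (ω + ψ₀)) • U' (ω + ψ₀)
      ∂(multivariateGaussian 0 M⁻¹))) (WithLp.toLp 2 (fun x : ι => if x ∈ Y then ζ x else 0) : EuclideanSpace ℝ ι) from by rw [map_add, hoff1, add_zero]]
  rw [map_add, hoff2, add_zero]

/-- **THE RESIDUAL IS `Y`-LOCAL**: `r(ζ) = r(ζ^Y)`, `ζ^Y_x = ζ_x` on `Y` and `0` off `Y`. [folklore] -/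
theorem block_residual_local (hM : M.PosDef) (hΓop : (γop • (1 : Matrix ι ι ℝ) - M⁻¹).PosSemidef) (Y : Finset ι)
    (hUd : ∀ φ : EuclideanSpace ℝ ι, HasFDerivAt U (U' φ) φ) (hU'd : ∀ φ : EuclideanSpace ℝ ι, HasFDerivAt U' (U'' φ) φ)
    (hU''c : Continuous U'') (hκ₀ : 0 ≤ κ₀) (hκ₁ : 0 ≤ κ₁) (ha : 0 ≤ a) (hκ₂ : 0 ≤ κ₂) (hτ : 0 < τ) (hδ : 0 < δ) (hθ0 : 0 < θ) (hθ1 : θ < 1)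
    (hκθ : (2 * κ₀ * (1 + τ) + 4 * δ) * γop ≤ θ) (hstab : ∀ φ : EuclideanSpace ℝ ι, -(κ₀ * ∑ x ∈ Y, φ x ^ 2) ≤ U φ)
    (hU'b : ∀ φ : EuclideanSpace ℝ ι, ‖U' φ‖ ≤ κ₁ * (a + ∑ x ∈ Y, φ x ^ 2)) (hU''b : ∀ φ : EuclideanSpace ℝ ι, ‖U'' φ‖ ≤ κ₂)
    (hUloc : ∀ φ φ' : EuclideanSpace ℝ ι, (∀ x ∈ Y, φ x = φ' x) → U φ = U φ') (ψ₀ ζ : EuclideanSpace ℝ ι) :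
    (Real.log (∫ ω : EuclideanSpace ℝ ι, exp (-U (ω + (ψ₀ + ζ))) ∂(multivariateGaussian 0 M⁻¹)) - Real.log (∫ ω : EuclideanSpace ℝ ι, exp (-U (ω + ψ₀))
        ∂(multivariateGaussian 0 M⁻¹)) + ((fun x : ι => ((∫ ω : EuclideanSpace ℝ ι, exp (-U (ω + ψ₀)) ∂(multivariateGaussian 0 M⁻¹))⁻¹ • ∫ ω : EuclideanSpace ℝ ι, exp (-U
        (ω + ψ₀)) • U' (ω + ψ₀) ∂(multivariateGaussian 0 M⁻¹)) (EuclideanSpace.single x (1 : ℝ))) ⬝ᵥ (WithLp.ofLp ζ)) + ((WithLp.ofLp ζ) ⬝ᵥ (Matrix.of fun x y : ι => (((∫ ω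
        : EuclideanSpace ℝ ι, exp (-U (ω + ψ₀)) ∂(multivariateGaussian 0 M⁻¹))⁻¹ • (∫ ω : EuclideanSpace ℝ ι, exp (-U (ω + ψ₀)) • (U'' (ω + ψ₀) - (U' (ω + ψ₀)).smulRight
        (U' (ω + ψ₀))) ∂(multivariateGaussian 0 M⁻¹)) + (((∫ ω : EuclideanSpace ℝ ι, exp (-U (ω + ψ₀)) ∂(multivariateGaussian 0 M⁻¹)) ^ 2)⁻¹ • ∫ ω : EuclideanSpace ℝ ι, exp
        (-U (ω + ψ₀)) • U' (ω + ψ₀) ∂(multivariateGaussian 0 M⁻¹)).smulRight (∫ ω : EuclideanSpace ℝ ι, exp (-U (ω + ψ₀)) • U' (ω + ψ₀) ∂(multivariateGaussian 0 M⁻¹)))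
        (EuclideanSpace.single x (1 : ℝ)) (EuclideanSpace.single y (1 : ℝ)) + ((∫ ω : EuclideanSpace ℝ ι, exp (-U (ω + ψ₀)) ∂(multivariateGaussian 0 M⁻¹))⁻¹ • (∫ ω :
        EuclideanSpace ℝ ι, exp (-U (ω + ψ₀)) • (U'' (ω + ψ₀) - (U' (ω + ψ₀)).smulRight (U' (ω + ψ₀))) ∂(multivariateGaussian 0 M⁻¹)) + (((∫ ω : EuclideanSpace ℝ ι, exp (-U
        (ω + ψ₀)) ∂(multivariateGaussian 0 M⁻¹)) ^ 2)⁻¹ • ∫ ω : EuclideanSpace ℝ ι, exp (-U (ω + ψ₀)) • U' (ω + ψ₀) ∂(multivariateGaussian 0 M⁻¹)).smulRight (∫ ω :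
        EuclideanSpace ℝ ι, exp (-U (ω + ψ₀)) • U' (ω + ψ₀) ∂(multivariateGaussian 0 M⁻¹))) (EuclideanSpace.single y (1 : ℝ)) (EuclideanSpace.single x (1 : ℝ))) / 2) *ᵥ
        (WithLp.ofLp ζ)) / 2) =
      (Real.log (∫ ω : EuclideanSpace ℝ ι, exp (-U (ω + (ψ₀ + (WithLp.toLp 2 (fun x : ι => if x ∈ Y then ζ x else 0) : EuclideanSpace ℝ ι)))) ∂(multivariateGaussian 0 M⁻¹))
          - Real.log (∫ ω : EuclideanSpace ℝ ι, exp (-U (ω + ψ₀)) ∂(multivariateGaussian 0 M⁻¹)) + ((fun x : ι => ((∫ ω : EuclideanSpace ℝ ι, exp (-U (ω + ψ₀))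
          ∂(multivariateGaussian 0 M⁻¹))⁻¹ • ∫ ω : EuclideanSpace ℝ ι, exp (-U (ω + ψ₀)) • U' (ω + ψ₀) ∂(multivariateGaussian 0 M⁻¹)) (EuclideanSpace.single x (1 : ℝ))) ⬝ᵥ
          (WithLp.ofLp (WithLp.toLp 2 (fun x : ι => if x ∈ Y then ζ x else 0) : EuclideanSpace ℝ ι))) + ((WithLp.ofLp (WithLp.toLp 2 (fun x : ι => if x ∈ Y then ζ x else 0)
          : EuclideanSpace ℝ ι)) ⬝ᵥ (Matrix.of fun x y : ι => (((∫ ω : EuclideanSpace ℝ ι, exp (-U (ω + ψ₀)) ∂(multivariateGaussian 0 M⁻¹))⁻¹ • (∫ ω : EuclideanSpace ℝ ι,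
          exp (-U (ω + ψ₀)) • (U'' (ω + ψ₀) - (U' (ω + ψ₀)).smulRight (U' (ω + ψ₀))) ∂(multivariateGaussian 0 M⁻¹)) + (((∫ ω : EuclideanSpace ℝ ι, exp (-U (ω + ψ₀))
          ∂(multivariateGaussian 0 M⁻¹)) ^ 2)⁻¹ • ∫ ω : EuclideanSpace ℝ ι, exp (-U (ω + ψ₀)) • U' (ω + ψ₀) ∂(multivariateGaussian 0 M⁻¹)).smulRight (∫ ω : EuclideanSpace ℝ
          ι, exp (-U (ω + ψ₀)) • U' (ω + ψ₀) ∂(multivariateGaussian 0 M⁻¹))) (EuclideanSpace.single x (1 : ℝ)) (EuclideanSpace.single y (1 : ℝ)) + ((∫ ω : EuclideanSpace ℝ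
          ι, exp (-U (ω + ψ₀)) ∂(multivariateGaussian 0 M⁻¹))⁻¹ • (∫ ω : EuclideanSpace ℝ ι, exp (-U (ω + ψ₀)) • (U'' (ω + ψ₀) - (U' (ω + ψ₀)).smulRight (U' (ω + ψ₀)))
          ∂(multivariateGaussian 0 M⁻¹)) + (((∫ ω : EuclideanSpace ℝ ι, exp (-U (ω + ψ₀)) ∂(multivariateGaussian 0 M⁻¹)) ^ 2)⁻¹ • ∫ ω : EuclideanSpace ℝ ι, exp (-U (ω +
          ψ₀)) • U' (ω + ψ₀) ∂(multivariateGaussian 0 M⁻¹)).smulRight (∫ ω : EuclideanSpace ℝ ι, exp (-U (ω + ψ₀)) • U' (ω + ψ₀) ∂(multivariateGaussian 0 M⁻¹)))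
          (EuclideanSpace.single y (1 : ℝ)) (EuclideanSpace.single x (1 : ℝ))) / 2) *ᵥ (WithLp.ofLp (WithLp.toLp 2 (fun x : ι => if x ∈ Y then ζ x else 0) : EuclideanSpace
          ℝ ι))) / 2) := by
  have hag : ∀ x ∈ Y, (ψ₀ + ζ) x = (ψ₀ + (WithLp.toLp 2 (fun x : ι => if x ∈ Y then ζ x else 0) : EuclideanSpace ℝ ι)) x := fun x hx => by simp [hx]
  have hU'c : Continuous U' := continuous_iff_continuousAt.2 fun φ => (hU'd φ).continuousAt
  rw [block_Z_local M⁻¹ Y hUloc (ψ₀ + ζ) (ψ₀ + (WithLp.toLp 2 (fun x : ι => if x ∈ Y then ζ x else 0) : EuclideanSpace ℝ ι)) hag, block_linear_local hM hΓop Y hUd hU'c hκ₀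
      hκ₁ ha hτ hδ hθ0 hθ1 hκθ hstab hU'b hUloc ψ₀ ζ,
    block_quadratic_local hM hΓop Y hUd hU'd hU''c hκ₀ hκ₁ ha hκ₂ hτ hδ hθ0 hθ1 hκθ hstab hU'b hU''b hUloc ψ₀ ζ]

/-! ## §2. THE END: the residual's global letter on `Y`, and the output's stability ∕ growth in the input format -/

/-- **THE BLOCK RESIDUAL'S GLOBAL LETTER IN `Σ_Y` FORM**: for a `Y`-local input, for EVERY `ζ`, `|r(ζ)| ≤ (λ + ½Λ)·Σ_Yζ²`. [folklore] -/
theorem block_residual_global_letter_local (hM : M.PosDef) (hfl : ∀ z : ι → ℝ, m * ∑ i, z i ^ 2 ≤ z ⬝ᵥ (M *ᵥ z)) (hΓop : (γop • (1 : Matrix ι ι ℝ) - M⁻¹).PosSemidef) (Y :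
    Finset ι)
    (hUd : ∀ φ : EuclideanSpace ℝ ι, HasFDerivAt U (U' φ) φ) (hU'd : ∀ φ : EuclideanSpace ℝ ι, HasFDerivAt U' (U'' φ) φ)
    (hU''c : Continuous U'') (hκ₀ : 0 ≤ κ₀) (hκ₁ : 0 ≤ κ₁) (ha : 0 ≤ a) (hκ₂ : 0 ≤ κ₂) (hτ : 0 < τ) (hδ : 0 < δ) (hθ0 : 0 < θ) (hθ1 : θ < 1)
    (hκθ : (2 * κ₀ * (1 + τ) + 4 * δ) * γop ≤ θ) (hstab : ∀ φ : EuclideanSpace ℝ ι, -(κ₀ * ∑ x ∈ Y, φ x ^ 2) ≤ U φ)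
    (hU'b : ∀ φ : EuclideanSpace ℝ ι, ‖U' φ‖ ≤ κ₁ * (a + ∑ x ∈ Y, φ x ^ 2)) (hU''b : ∀ φ : EuclideanSpace ℝ ι, ‖U'' φ‖ ≤ κ₂) {Λ : ℝ}
    (hwup : ∀ φ φ' : EuclideanSpace ℝ ι, U φ' ≤ U φ + U' φ (φ' - φ) + Λ / 2 * ∑ x ∈ Y, (φ' x - φ x) ^ 2) (hlam : 0 ≤ lam)
    (hUsec : ∀ s : ℝ, 0 ≤ s → s ≤ 1 → ∀ a b : EuclideanSpace ℝ ι,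
      U ((1 - s) • a + s • b) - lam / 2 * (s * (1 - s)) * ∑ i, (a i - b i) ^ 2 ≤ (1 - s) * U a + s * U b)
    (hm : 2 * lam ≤ m) (hUloc : ∀ φ φ' : EuclideanSpace ℝ ι, (∀ x ∈ Y, φ x = φ' x) → U φ = U φ') (ψ₀ ζ : EuclideanSpace ℝ ι) :
    |(Real.log (∫ ω : EuclideanSpace ℝ ι, exp (-U (ω + (ψ₀ + ζ))) ∂(multivariateGaussian 0 M⁻¹)) - Real.log (∫ ω : EuclideanSpace ℝ ι, exp (-U (ω + ψ₀))
        ∂(multivariateGaussian 0 M⁻¹)) + ((fun x : ι => ((∫ ω : EuclideanSpace ℝ ι, exp (-U (ω + ψ₀)) ∂(multivariateGaussian 0 M⁻¹))⁻¹ • ∫ ω : EuclideanSpace ℝ ι, exp (-U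
        (ω + ψ₀)) • U' (ω + ψ₀) ∂(multivariateGaussian 0 M⁻¹)) (EuclideanSpace.single x (1 : ℝ))) ⬝ᵥ (WithLp.ofLp ζ)) + ((WithLp.ofLp ζ) ⬝ᵥ (Matrix.of fun x y : ι => (((∫ ω
        : EuclideanSpace ℝ ι, exp (-U (ω + ψ₀)) ∂(multivariateGaussian 0 M⁻¹))⁻¹ • (∫ ω : EuclideanSpace ℝ ι, exp (-U (ω + ψ₀)) • (U'' (ω + ψ₀) - (U' (ω + ψ₀)).smulRight
        (U' (ω + ψ₀))) ∂(multivariateGaussian 0 M⁻¹)) + (((∫ ω : EuclideanSpace ℝ ι, exp (-U (ω + ψ₀)) ∂(multivariateGaussian 0 M⁻¹)) ^ 2)⁻¹ • ∫ ω : EuclideanSpace ℝ ι, exp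
        (-U (ω + ψ₀)) • U' (ω + ψ₀) ∂(multivariateGaussian 0 M⁻¹)).smulRight (∫ ω : EuclideanSpace ℝ ι, exp (-U (ω + ψ₀)) • U' (ω + ψ₀) ∂(multivariateGaussian 0 M⁻¹)))
        (EuclideanSpace.single x (1 : ℝ)) (EuclideanSpace.single y (1 : ℝ)) + ((∫ ω : EuclideanSpace ℝ ι, exp (-U (ω + ψ₀)) ∂(multivariateGaussian 0 M⁻¹))⁻¹ • (∫ ω :
        EuclideanSpace ℝ ι, exp (-U (ω + ψ₀)) • (U'' (ω + ψ₀) - (U' (ω + ψ₀)).smulRight (U' (ω + ψ₀))) ∂(multivariateGaussian 0 M⁻¹)) + (((∫ ω : EuclideanSpace ℝ ι, exp (-U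
        (ω + ψ₀)) ∂(multivariateGaussian 0 M⁻¹)) ^ 2)⁻¹ • ∫ ω : EuclideanSpace ℝ ι, exp (-U (ω + ψ₀)) • U' (ω + ψ₀) ∂(multivariateGaussian 0 M⁻¹)).smulRight (∫ ω :
        EuclideanSpace ℝ ι, exp (-U (ω + ψ₀)) • U' (ω + ψ₀) ∂(multivariateGaussian 0 M⁻¹))) (EuclideanSpace.single y (1 : ℝ)) (EuclideanSpace.single x (1 : ℝ))) / 2) *ᵥ
        (WithLp.ofLp ζ)) / 2)| ≤ (lam + Λ / 2) * (∑ x ∈ Y, ζ x ^ 2) := by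
  rw [block_residual_local hM hΓop Y hUd hU'd hU''c hκ₀ hκ₁ ha hκ₂ hτ hδ hθ0 hθ1 hκθ hstab hU'b hU''b hUloc ψ₀ ζ]
  have h := block_residual_global_letter hM hfl hΓop Y hUd hU'd hU''c hκ₀ hκ₁ ha hκ₂ hτ hδ hθ0 hθ1 hκθ hstab hU'b hU''b hwup hlam hUsec hm ψ₀ (WithLp.toLp 2 (fun x : ι =>
      if x ∈ Y then ζ x else 0) : EuclideanSpace ℝ ι)
  have e1 : (∑ i, ((WithLp.toLp 2 (fun x : ι => if x ∈ Y then ζ x else 0) : EuclideanSpace ℝ ι)) i ^ 2) = (∑ x ∈ Y, ζ x ^ 2) := by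
    have hi : ∀ i, ((WithLp.toLp 2 (fun x : ι => if x ∈ Y then ζ x else 0) : EuclideanSpace ℝ ι)) i ^ 2 = if i ∈ Y then ζ i ^ 2 else 0 := fun i => by
      rw [PiLp.toLp_apply]; split_ifs <;> simp
    simp_rw [hi]
    rw [Finset.sum_ite_mem, Finset.univ_inter]
  have e2 : (∑ x ∈ Y, ((WithLp.toLp 2 (fun x : ι => if x ∈ Y then ζ x else 0) : EuclideanSpace ℝ ι)) x ^ 2) = (∑ x ∈ Y, ζ x ^ 2) := Finset.sum_congr rfl fun x hx => by rw
      [PiLp.toLp_apply, if_pos hx]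
  rw [e1, e2, ← add_mul] at h
  exact h

/-- **THE OUTPUT'S STABILITY AND UPPER GROWTH IN THE INPUT FORMAT**: for a `Y`-local input, the next single-block potential `w⁺ = −r`
satisfies `−((λ+½Λ)·Σ_Yζ²) ≤ w⁺(ζ)` (the input's `hstab` with `κ₀⁺ = λ+½Λ`) and `w⁺(ζ) ≤ (λ+½Λ)·(0 + Σ_Yζ²)` (the input's `hUup` with
`κ_u⁺ = λ+½Λ`, `a_u⁺ = 0`), for EVERY `ζ`. [folklore] -/
theorem block_output_stability_and_growth (hM : M.PosDef) (hfl : ∀ z : ι → ℝ, m * ∑ i, z i ^ 2 ≤ z ⬝ᵥ (M *ᵥ z)) (hΓop : (γop • (1 : Matrix ι ι ℝ) - M⁻¹).PosSemidef) (Y :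
    Finset ι)
    (hUd : ∀ φ : EuclideanSpace ℝ ι, HasFDerivAt U (U' φ) φ) (hU'd : ∀ φ : EuclideanSpace ℝ ι, HasFDerivAt U' (U'' φ) φ)
    (hU''c : Continuous U'') (hκ₀ : 0 ≤ κ₀) (hκ₁ : 0 ≤ κ₁) (ha : 0 ≤ a) (hκ₂ : 0 ≤ κ₂) (hτ : 0 < τ) (hδ : 0 < δ) (hθ0 : 0 < θ) (hθ1 : θ < 1)
    (hκθ : (2 * κ₀ * (1 + τ) + 4 * δ) * γop ≤ θ) (hstab : ∀ φ : EuclideanSpace ℝ ι, -(κ₀ * ∑ x ∈ Y, φ x ^ 2) ≤ U φ)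
    (hU'b : ∀ φ : EuclideanSpace ℝ ι, ‖U' φ‖ ≤ κ₁ * (a + ∑ x ∈ Y, φ x ^ 2)) (hU''b : ∀ φ : EuclideanSpace ℝ ι, ‖U'' φ‖ ≤ κ₂) {Λ : ℝ}
    (hwup : ∀ φ φ' : EuclideanSpace ℝ ι, U φ' ≤ U φ + U' φ (φ' - φ) + Λ / 2 * ∑ x ∈ Y, (φ' x - φ x) ^ 2) (hlam : 0 ≤ lam)
    (hUsec : ∀ s : ℝ, 0 ≤ s → s ≤ 1 → ∀ a b : EuclideanSpace ℝ ι,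
      U ((1 - s) • a + s • b) - lam / 2 * (s * (1 - s)) * ∑ i, (a i - b i) ^ 2 ≤ (1 - s) * U a + s * U b)
    (hm : 2 * lam ≤ m) (hUloc : ∀ φ φ' : EuclideanSpace ℝ ι, (∀ x ∈ Y, φ x = φ' x) → U φ = U φ') (ψ₀ ζ : EuclideanSpace ℝ ι) :
    -((lam + Λ / 2) * (∑ x ∈ Y, ζ x ^ 2)) ≤ -(Real.log (∫ ω : EuclideanSpace ℝ ι, exp (-U (ω + (ψ₀ + ζ))) ∂(multivariateGaussian 0 M⁻¹)) - Real.log (∫ ω : EuclideanSpace ℝ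
        ι, exp (-U (ω + ψ₀)) ∂(multivariateGaussian 0 M⁻¹)) + ((fun x : ι => ((∫ ω : EuclideanSpace ℝ ι, exp (-U (ω + ψ₀)) ∂(multivariateGaussian 0 M⁻¹))⁻¹ • ∫ ω :
        EuclideanSpace ℝ ι, exp (-U (ω + ψ₀)) • U' (ω + ψ₀) ∂(multivariateGaussian 0 M⁻¹)) (EuclideanSpace.single x (1 : ℝ))) ⬝ᵥ (WithLp.ofLp ζ)) + ((WithLp.ofLp ζ) ⬝ᵥ
        (Matrix.of fun x y : ι => (((∫ ω : EuclideanSpace ℝ ι, exp (-U (ω + ψ₀)) ∂(multivariateGaussian 0 M⁻¹))⁻¹ • (∫ ω : EuclideanSpace ℝ ι, exp (-U (ω + ψ₀)) • (U'' (ω +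
        ψ₀) - (U' (ω + ψ₀)).smulRight (U' (ω + ψ₀))) ∂(multivariateGaussian 0 M⁻¹)) + (((∫ ω : EuclideanSpace ℝ ι, exp (-U (ω + ψ₀)) ∂(multivariateGaussian 0 M⁻¹)) ^ 2)⁻¹ •
        ∫ ω : EuclideanSpace ℝ ι, exp (-U (ω + ψ₀)) • U' (ω + ψ₀) ∂(multivariateGaussian 0 M⁻¹)).smulRight (∫ ω : EuclideanSpace ℝ ι, exp (-U (ω + ψ₀)) • U' (ω + ψ₀)
        ∂(multivariateGaussian 0 M⁻¹))) (EuclideanSpace.single x (1 : ℝ)) (EuclideanSpace.single y (1 : ℝ)) + ((∫ ω : EuclideanSpace ℝ ι, exp (-U (ω + ψ₀))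
        ∂(multivariateGaussian 0 M⁻¹))⁻¹ • (∫ ω : EuclideanSpace ℝ ι, exp (-U (ω + ψ₀)) • (U'' (ω + ψ₀) - (U' (ω + ψ₀)).smulRight (U' (ω + ψ₀))) ∂(multivariateGaussian 0
        M⁻¹)) + (((∫ ω : EuclideanSpace ℝ ι, exp (-U (ω + ψ₀)) ∂(multivariateGaussian 0 M⁻¹)) ^ 2)⁻¹ • ∫ ω : EuclideanSpace ℝ ι, exp (-U (ω + ψ₀)) • U' (ω + ψ₀)
        ∂(multivariateGaussian 0 M⁻¹)).smulRight (∫ ω : EuclideanSpace ℝ ι, exp (-U (ω + ψ₀)) • U' (ω + ψ₀) ∂(multivariateGaussian 0 M⁻¹))) (EuclideanSpace.single y (1 :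
        ℝ)) (EuclideanSpace.single x (1 : ℝ))) / 2) *ᵥ (WithLp.ofLp ζ)) / 2) ∧
      -(Real.log (∫ ω : EuclideanSpace ℝ ι, exp (-U (ω + (ψ₀ + ζ))) ∂(multivariateGaussian 0 M⁻¹)) - Real.log (∫ ω : EuclideanSpace ℝ ι, exp (-U (ω + ψ₀))
          ∂(multivariateGaussian 0 M⁻¹)) + ((fun x : ι => ((∫ ω : EuclideanSpace ℝ ι, exp (-U (ω + ψ₀)) ∂(multivariateGaussian 0 M⁻¹))⁻¹ • ∫ ω : EuclideanSpace ℝ ι, exp (-U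
          (ω + ψ₀)) • U' (ω + ψ₀) ∂(multivariateGaussian 0 M⁻¹)) (EuclideanSpace.single x (1 : ℝ))) ⬝ᵥ (WithLp.ofLp ζ)) + ((WithLp.ofLp ζ) ⬝ᵥ (Matrix.of fun x y : ι => (((∫
          ω : EuclideanSpace ℝ ι, exp (-U (ω + ψ₀)) ∂(multivariateGaussian 0 M⁻¹))⁻¹ • (∫ ω : EuclideanSpace ℝ ι, exp (-U (ω + ψ₀)) • (U'' (ω + ψ₀) - (U' (ω +
          ψ₀)).smulRight (U' (ω + ψ₀))) ∂(multivariateGaussian 0 M⁻¹)) + (((∫ ω : EuclideanSpace ℝ ι, exp (-U (ω + ψ₀)) ∂(multivariateGaussian 0 M⁻¹)) ^ 2)⁻¹ • ∫ ω :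
          EuclideanSpace ℝ ι, exp (-U (ω + ψ₀)) • U' (ω + ψ₀) ∂(multivariateGaussian 0 M⁻¹)).smulRight (∫ ω : EuclideanSpace ℝ ι, exp (-U (ω + ψ₀)) • U' (ω + ψ₀)
          ∂(multivariateGaussian 0 M⁻¹))) (EuclideanSpace.single x (1 : ℝ)) (EuclideanSpace.single y (1 : ℝ)) + ((∫ ω : EuclideanSpace ℝ ι, exp (-U (ω + ψ₀))
          ∂(multivariateGaussian 0 M⁻¹))⁻¹ • (∫ ω : EuclideanSpace ℝ ι, exp (-U (ω + ψ₀)) • (U'' (ω + ψ₀) - (U' (ω + ψ₀)).smulRight (U' (ω + ψ₀))) ∂(multivariateGaussian 0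
          M⁻¹)) + (((∫ ω : EuclideanSpace ℝ ι, exp (-U (ω + ψ₀)) ∂(multivariateGaussian 0 M⁻¹)) ^ 2)⁻¹ • ∫ ω : EuclideanSpace ℝ ι, exp (-U (ω + ψ₀)) • U' (ω + ψ₀)
          ∂(multivariateGaussian 0 M⁻¹)).smulRight (∫ ω : EuclideanSpace ℝ ι, exp (-U (ω + ψ₀)) • U' (ω + ψ₀) ∂(multivariateGaussian 0 M⁻¹))) (EuclideanSpace.single y (1 :
          ℝ)) (EuclideanSpace.single x (1 : ℝ))) / 2) *ᵥ (WithLp.ofLp ζ)) / 2) ≤ (lam + Λ / 2) * (0 + (∑ x ∈ Y, ζ x ^ 2)) := by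
  have h := block_residual_global_letter_local hM hfl hΓop Y hUd hU'd hU''c hκ₀ hκ₁ ha hκ₂ hτ hδ hθ0 hθ1 hκθ hstab hU'b hU''b hwup hlam hUsec hm hUloc ψ₀ ζ
  rw [abs_le] at h
  rw [zero_add]
  exact ⟨by linarith [h.2], by linarith [h.1]⟩

end Local

/-! ## §3. Toy -/

/-- Toy (§2's reindexing): `Σ_i 1_Y(i)·c = #Y·c`. -/
example (Y : Finset ι) (c : ℝ) : (∑ i, if i ∈ Y then c else 0) = Y.card * c := by
  rw [Finset.sum_ite_mem, Finset.univ_inter, Finset.sum_const, nsmul_eq_mul]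

end Summit.QuantumFields.BalabanUV.T4Continuum.NE7b.SupBlockLocalResidual
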